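import Summits.KontsevichZagierPeriods.KontsevichZagierPeriods.Theorems.SymplecticScissorsRealOnePeriodRelationsStubTorsArcs

/-!
# Crux `RealOnePeriodRelations` (stmt-KontsevichZagierPeriods-10042), line `nash-retraction-thin-strip`,
# reshape 11 (cycle 9, the torsion / third-kind layer with complex poles): stub `stub_torsArcsC`

A `(P, D)`-TORSION CELL `∫_a^b P(x) dx / (D(x) √(x³ + Ax + B))` (`A, B, a < b` real algebraic,
`f = x³ + Ax + B > 0` on `(a, b)`, `P, D` with real algebraic coefficients, `D ≠ 0` on `[a, b]`, every complex
root of `D` a torsion abscissa `℘(v)` of the lattice `M` with `g₂ = −4A`, `g₃ = −4B`; complex-conjugate pairs of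
roots allowed) is, modulo `M₁ = closure (1a ∪ 1b ∪ 2 ∪ Green)`, the real realisation of ONE period symbol on the
torsion-punctured Weierstrass curve `C_T = {y² = f(x), w · ∏_{e ∈ T} (x − e) = 1}` (`curveP M T`), `T` the set
of complex roots of `D` (Huber–Wüstholz 2022, §3.3.1: symbols `(Z, ω, γ)`; §13.2: the elliptic curve of a lattice).
This is the landed real-root version `stub_torsArcs` with two new points:

* the PATH `Γ(t) = (x(t), √f(x(t)), 1/∏_{e ∈ T}(x(t) − e))`, `x(t) = a + (b − a)(3t² − 2t³)`, now has a genuinely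
  complex third coordinate; its real and imaginary parts are `ℚ`-semialgebraic on `[0, 1]` by the complex-valued
  semialgebraic kit (`re_im_finsetProd`, `re_im_inv`: `Re w = Re R/|R|²`, `Im w = −Im R/|R|²` for
  `R = ∏ (x − e)`, which does not vanish on `[a, b]`) — `exists_pathPC`;
* the FORM is `Q · ι^*(G dx + H dy)` with `(G, H)` realising `P/√f` (`EllipticLayer.stub_ellForm`) and
  `Q = lc(D)⁻¹ · ∏_{e ∈ T} (invX T e)^{mult_e(D)}`, so that `Q = 1/D(x)` on `C_T` by the splitting
  `D = lc(D) ∏_{e ∈ T} (x − e)^{mult_e(D)}` over `ℂ` — `eval_invD_of_mem`.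

Along `Γ` the `dw`-component of the pull-back vanishes, the realisation integrand on `(0, 1)` is
`ρ.integrand(x(t)) · x′(t)`, and rule 2 along `x(·)` (`EllipticLayer.stub_ellRealise`) identifies the cell with the
realisation (value bookkeeping verbatim from `stub_torsArcs`).

[cite: HuberWustholz2022, §3.3.1, §13.2] [cite: KontsevichZagier2001, §1.2]
-/

noncomputable section

open scoped BigOperators Topology PeriodPair
open Set Filter MvPolynomial Complex MeasureTheory
open Literature.NumberTheory.Transcendental Literature.NumberTheory.Transcendental.CurvePeriods
open Literature.NumberTheory.Transcendental.CurvePeriods.Ell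
open Literature.ModelTheory.ExponentialFields (IsSemialgebraic)
open Summit.KontsevichZagierPeriods.SymplecticScissors.RealOnePeriodRelationsNegative (M₁ H₁)

namespace Summit.KontsevichZagierPeriods.SymplecticScissors.RealOnePeriodRelations

namespace TorsionLayer

/-! ## `Q = lc⁻¹ ∏ (invX T e)^{m_e}` is `1/D` on `C_T` -/

/-- For a polynomial `D = lc · ∏_{e ∈ T} (x − e)^{m_e}` split over `ℂ`, the polynomial
`Q = lc⁻¹ · ∏_{e ∈ T} (invX T e)^{m_e}` on `C_T` is `1/D(x)` at every point of `C_T`. [cite: HuberWustholz2022, §13.2] -/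
theorem eval_invD_of_mem {M : PeriodPair} {T : Finset ℂ} {lc : ℂ} {m : ℂ → ℕ} {D : Polynomial ℂ}
    (hD : D = Polynomial.C lc * ∏ e ∈ T, (Polynomial.X - Polynomial.C e) ^ m e) {q : Fin 3 → ℂ}
    (hq : q ∈ (curveP M T).points) :
    eval q (C lc⁻¹ * ∏ e ∈ T, invX T e ^ m e) = (D.eval (q 0))⁻¹ := by
  have hprod : ∏ e ∈ T, eval q (invX T e ^ m e) = ∏ e ∈ T, ((q 0 - e) ^ m e)⁻¹ :=
    Finset.prod_congr rfl fun e he => by rw [map_pow, eval_invX_of_mem he hq, inv_pow]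
  rw [map_mul, MvPolynomial.eval_C, map_prod, hprod, hD]
  simp only [Polynomial.eval_mul, Polynomial.eval_C, Polynomial.eval_prod, Polynomial.eval_pow,
    Polynomial.eval_sub, Polynomial.eval_X, mul_inv, Finset.prod_inv_distrib]

/-! ## The path `Γ = (x, √f ∘ x, 1/∏(x − e))` on `C_T` with complex punctures -/

/-- THE PATH on `C_T` (complex punctures): for `f = x³ + Ax + B > 0` on `(a, b)` (`A, B, a < b` real algebraic,
`4A³ + 27B² ≠ 0`), `x(t) = a + (b − a)(3t² − 2t³)`, a lattice `M` with `g₂ = −4A`, `g₃ = −4B` and a finite set `T` of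
algebraic complex abscissae off the real segment `[a, b]`, the map `t ↦ (x(t), √f(x(t)), 1/∏_{e ∈ T}(x(t) − e))` is a
`C¹` path on `C_T = curveP M T` with algebraic end points and `ℚ`-semialgebraic real and imaginary parts on `[0, 1]`
(`Re` and `Im` of `1/R`, `R = ∏ (x − e)`, are `Re R/|R|²` and `−Im R/|R|²`). [cite: HuberWustholz2022, §3.3.1] -/
theorem exists_pathPC {A B a b : ℝ} {f xt : ℝ → ℝ} (hf : ∀ x, f x = x ^ 3 + A * x + B)
    (hxt : ∀ t, xt t = a + (b - a) * (3 * t ^ 2 - 2 * t ^ 3))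
    (hA : IsAlgebraic ℚ A) (hB : IsAlgebraic ℚ B) (ha : IsAlgebraic ℚ a) (hb : IsAlgebraic ℚ b)
    (hab : a < b) (hD : 4 * A ^ 3 + 27 * B ^ 2 ≠ 0) (hpos : ∀ x ∈ Ioo a b, 0 < f x)
    {M : PeriodPair} (hM₂ : M.g₂ = -4 * (A : ℂ)) (hM₃ : M.g₃ = -4 * (B : ℂ))
    {T : Finset ℂ} (hT : ∀ e ∈ T, IsAlgebraic ℚ e ∧ ∀ x ∈ Icc a b, (x : ℂ) ≠ e) :
    ∃ Γ : CurvePath (curveP M T),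
      (∀ t : ℝ, Γ.toFun t =
        ![((xt t : ℝ) : ℂ), ((Real.sqrt (f (xt t)) : ℝ) : ℂ), (∏ e ∈ T, ((xt t : ℂ) - e))⁻¹]) ∧
      IsSemialgebraicMapOn ℚ {z : Fin 1 → ℝ | z 0 ∈ Icc (0 : ℝ) 1}
        (fun z => Fin.append (fun i => (Γ.toFun (z 0) i).re) (fun i => (Γ.toFun (z 0) i).im)) := by
  have hfe : f = fun x => x ^ 3 + A * x + B := funext hf
  have hxe : xt = fun t => a + (b - a) * (3 * t ^ 2 - 2 * t ^ 3) := funext hxt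
  have hAM : Ell.A M = (A : ℂ) := by rw [Ell.A, hM₂]; ring
  have hBM : Ell.B M = (B : ℂ) := by rw [Ell.B, hM₃]; ring
  -- values at the end points
  have hx0 : xt 0 = a := by rw [hxt]; ring
  have hx1 : xt 1 = b := by rw [hxt]; ring
  have hfalg : ∀ {e : ℝ}, IsAlgebraic ℚ e → IsAlgebraic ℚ (Real.sqrt (f e)) := fun {e} he => by
    have hr : IsAlgebraic ℚ (f e) := by
      rw [hf]
      exact ((he.pow 3).add (hA.mul he)).add hB
    rcases le_or_gt 0 (f e) with h | h
    · exact IsAlgebraic.of_pow two_pos (by rwa [Real.sq_sqrt h])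
    · rw [Real.sqrt_eq_zero'.mpr h.le]
      exact isAlgebraic_zero
  have hWalg : ∀ {e : ℝ}, IsAlgebraic ℚ e → IsAlgebraic ℚ (∏ c ∈ T, ((e : ℂ) - c))⁻¹ := fun {e} he =>
    (Finset.prod_induction _ (IsAlgebraic ℚ) (fun _ _ h h' => h.mul h') isAlgebraic_one
      fun c hc => he.algebraMap.sub (hT c hc).1).inv
  have halg_end : ∀ {e : ℝ}, IsAlgebraic ℚ e → ∀ i : Fin 3, IsAlgebraic ℚ
      ((![((e : ℝ) : ℂ), ((Real.sqrt (f e) : ℝ) : ℂ), (∏ c ∈ T, ((e : ℂ) - c))⁻¹] : Fin 3 → ℂ) i) := by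
    intro e he i
    fin_cases i
    · exact he.algebraMap
    · exact (hfalg he).algebraMap
    · exact hWalg he
  -- `x([0, 1]) ⊆ [a, b]`, so `f ∘ x ≥ 0` and `∏ (x − e) ≠ 0` on `[0, 1]`
  have hf_cont : Continuous f := by rw [hfe]; fun_prop
  have hf_nonneg : ∀ x ∈ Icc a b, 0 ≤ f x := EllipticLayer.nonneg_on_Icc_of_pos_on_Ioo hf_cont hab hpos
  have hxmem : ∀ t ∈ Icc (0 : ℝ) 1, xt t ∈ Icc a b := fun t ht => by
    rw [hxt]; exact EllipticLayer.cubicChart_mem_Icc hab ht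
  have hg_nonneg : ∀ t ∈ Icc (0 : ℝ) 1, 0 ≤ f (xt t) := fun t ht => hf_nonneg _ (hxmem t ht)
  have hprod_ne : ∀ t ∈ Icc (0 : ℝ) 1, ∏ c ∈ T, ((xt t : ℂ) - c) ≠ 0 := fun t ht =>
    Finset.prod_ne_zero_iff.2 fun c hc => sub_ne_zero.2 ((hT c hc).2 _ (hxmem t ht))
  -- regularity
  have hx_cd : ContDiff ℝ 1 xt := by rw [hxe]; fun_prop
  have hs_cd : ContDiffOn ℝ 1 (fun t => Real.sqrt (f (xt t))) (Icc 0 1) :=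
    EllipticLayer.sqrt_comp_contDiffOn hf hxt hab hD hpos
  have hxC_cd : ContDiff ℝ 1 fun t => ((xt t : ℝ) : ℂ) := ofRealCLM.contDiff.comp hx_cd
  have hp_cd : ContDiff ℝ 1 fun t => ∏ c ∈ T, ((xt t : ℂ) - c) :=
    contDiff_prod fun c _ => hxC_cd.sub contDiff_const
  have hw_cd : ContDiffOn ℝ 1 (fun t => (∏ c ∈ T, ((xt t : ℂ) - c))⁻¹) (Icc 0 1) :=
    hp_cd.contDiffOn.inv hprod_ne
  let Γ : CurvePath (curveP M T) :=
    { toFun := fun t => ![((xt t : ℝ) : ℂ), ((Real.sqrt (f (xt t)) : ℝ) : ℂ), (∏ e ∈ T, ((xt t : ℂ) - e))⁻¹]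
      contDiffOn := by
        refine contDiffOn_pi.2 fun i => ?_
        fin_cases i
        · exact hxC_cd.contDiffOn
        · exact ofRealCLM.contDiff.comp_contDiffOn hs_cd
        · exact hw_cd
      mem_points := fun t ht => by
        rw [mem_points_curveP_iff, hAM, hBM]
        refine ⟨?_, ?_⟩
        · simp only [Matrix.cons_val_one, Matrix.cons_val_zero]
          have h := Real.sq_sqrt (hg_nonneg t ht)
          rw [hf] at h ⊢
          exact_mod_cast h
        · exact inv_mul_cancel₀ (hprod_ne t ht)
      algebraic_zero := fun i => by
        show IsAlgebraic ℚ ((![((xt 0 : ℝ) : ℂ), ((Real.sqrt (f (xt 0)) : ℝ) : ℂ),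
          (∏ e ∈ T, ((xt 0 : ℂ) - e))⁻¹] : Fin 3 → ℂ) i)
        rw [hx0]
        exact halg_end ha i
      algebraic_one := fun i => by
        show IsAlgebraic ℚ ((![((xt 1 : ℝ) : ℂ), ((Real.sqrt (f (xt 1)) : ℝ) : ℂ),
          (∏ e ∈ T, ((xt 1 : ℂ) - e))⁻¹] : Fin 3 → ℂ) i)
        rw [hx1]
        exact halg_end hb i }
  have hΓ : Γ.toFun = fun t : ℝ =>
      (![((xt t : ℝ) : ℂ), ((Real.sqrt (f (xt t)) : ℝ) : ℂ), (∏ e ∈ T, ((xt t : ℂ) - e))⁻¹] :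
        Fin 3 → ℂ) := rfl
  refine ⟨Γ, fun t => rfl, ?_⟩
  -- the realified path is `ℚ`-semialgebraic on `[0, 1]`
  have hdom : IsSemialgebraic ℚ {z : Fin 1 → ℝ | z 0 ∈ Icc (0 : ℝ) 1} := Realises.isSemialgebraic_IccDom
  have hz : IsSemialgebraicFunOn ℚ {z : Fin 1 → ℝ | z 0 ∈ Icc (0 : ℝ) 1} (fun z => z 0) :=
    (isSemialgebraicFunOn_aeval hdom (X 0)).congr fun z _ => by simp
  have hX : IsSemialgebraicFunOn ℚ {z : Fin 1 → ℝ | z 0 ∈ Icc (0 : ℝ) 1} (fun z => xt (z 0)) :=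
    ((isSemialgebraicFunOn_const_of_isAlgebraic hdom ha).fun_add
      ((isSemialgebraicFunOn_const_of_isAlgebraic hdom (hb.sub ha)).fun_mul
        (((isSemialgebraicFunOn_const_natCast hdom 3).fun_mul (hz.fun_pow 2)).fun_sub
          ((isSemialgebraicFunOn_const_natCast hdom 2).fun_mul (hz.fun_pow 3))))).congr
      fun z _ => by rw [hxt]; push_cast; ring
  have hG : IsSemialgebraicFunOn ℚ {z : Fin 1 → ℝ | z 0 ∈ Icc (0 : ℝ) 1} (fun z => f (xt (z 0))) :=
    (((hX.fun_pow 3).fun_add ((isSemialgebraicFunOn_const_of_isAlgebraic hdom hA).fun_mul hX)).fun_add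
      (isSemialgebraicFunOn_const_of_isAlgebraic hdom hB)).congr fun z _ => (hf _).symm
  have hS := hG.fun_sqrt
  have hW := re_im_inv (HomotopyInvariance.re_im_finsetProd
      (F := fun e z => ((xt (z 0) : ℝ) : ℂ) - e) hdom T fun e he =>
      re_im_sub (re_im_ofReal hdom hX)
        (re_im_const hdom (isAlgebraic_re_im (hT e he).1).1 (isAlgebraic_re_im (hT e he).1).2))
    fun z hz => hprod_ne _ hz
  show IsSemialgebraicMapOn ℚ {z : Fin 1 → ℝ | z 0 ∈ Icc (0 : ℝ) 1}
    (fun z => Fin.append (m := 3) (n := 3) (fun i => (Γ.toFun (z 0) i).re)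
      (fun i => (Γ.toFun (z 0) i).im))
  refine IsSemialgebraicMapOn.of_forall hdom fun j => ?_
  refine Fin.addCases (fun i => ?_) (fun i => ?_) j
  · simp only [Fin.append_left, hΓ]
    fin_cases i
    · exact hX.congr fun z _ => by simp
    · exact hS.congr fun z _ => by simp
    · exact hW.1.congr fun z _ => by simp
  · simp only [Fin.append_right, hΓ]
    fin_cases i
    · exact (isSemialgebraicFunOn_natCast hdom 0).congr fun z _ => by simp
    · exact (isSemialgebraicFunOn_natCast hdom 0).congr fun z _ => by simp
    · exact hW.2.congr fun z _ => by simp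

/-! ## The stub -/

/-- **Stub `stub_torsArcsC`** — ARCS for `(P, D)`-torsion cells with complex torsion poles: the cell
`∫_a^b P(x) dx/(D(x) √(x³ + Ax + B))` (`D ≠ 0` on `[a, b]`, every complex root of `D` a torsion abscissa) is, modulo
`M₁`, the real realisation of ONE period symbol on `C_T`, `T` the complex root set of `D`, with the same value: path
`t ↦ (x(t), √f(x(t)), 1/∏_{e ∈ T}(x(t) − e))`, `x(t) = a + (b − a)(3t² − 2t³)`, form
`(lc(D)⁻¹ ∏_{e ∈ T} (invX T e)^{mult_e D}) • ι^*(G dx + H dy)` with `(G, H)` from `stub_ellForm` for `P₁ = P₂ = 0`,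
`P₃ = P`. [cite: HuberWustholz2022, §3.3.1, §13.2] [cite: KontsevichZagier2001, §1.2] -/
theorem stub_torsArcsC : ∀ (A B : ℝ), IsAlgebraic ℚ A → IsAlgebraic ℚ B → 4 * A ^ 3 + 27 * B ^ 2 ≠ 0 →
    ∀ (M : PeriodPair), M.g₂ = -4 * (A : ℂ) → M.g₃ = -4 * (B : ℂ) →
    ∀ ρ : KZ.IntegralRep 1,
    (∃ a b : ℝ, IsAlgebraic ℚ a ∧ IsAlgebraic ℚ b ∧ a < b ∧ ρ.domain = {z | z 0 ∈ Set.Ioo a b} ∧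
        (∀ x ∈ Set.Ioo a b, 0 < x ^ 3 + A * x + B) ∧
        ∃ P D : Polynomial (algebraicClosure ℚ ℝ), (∀ x ∈ Set.Icc a b, Polynomial.aeval x D ≠ 0) ∧
          (∀ z : ℂ, Polynomial.aeval z D = 0 →
            ∃ v : ℂ, v ∉ M.lattice ∧ (∃ n : ℕ, 1 ≤ n ∧ (n : ℂ) * v ∈ M.lattice) ∧ ℘[M] v = z) ∧
          ∀ x ∈ Set.Ioo a b, ρ.integrand (fun _ => x) =
            Polynomial.aeval x P / (Polynomial.aeval x D * Real.sqrt (x ^ 3 + A * x + B))) →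
    ∃ (C : PeriodSymbol →₀ ℂ) (R : PeriodSymbol → KZ.IntegralRep 1), (∀ s, IsAlgebraic ℚ (C s)) ∧
      (∀ s ∈ C.support, ∃ T : Finset ℂ,
        (∀ a ∈ T, ∃ v : ℂ, IsAlgPt M v ∧ (∃ n : ℕ, 1 ≤ n ∧ (n : ℂ) * v ∈ M.lattice) ∧ ℘[M] v = a) ∧
        s.Z = curveP M T) ∧
      (∀ s ∈ C.support, IsSemialgebraicMapOn ℚ {z : Fin 1 → ℝ | z 0 ∈ Set.Icc (0 : ℝ) 1}
        (fun z => Fin.append (fun i => (s.γ.toFun (z 0) i).re) (fun i => (s.γ.toFun (z 0) i).im))) ∧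
      (∀ s ∈ C.support, (R s).domain = {z | z 0 ∈ Set.Ioo (0 : ℝ) 1} ∧ ∀ z ∈ (R s).domain, (R s).integrand z =
        (C s * ∑ i, MvPolynomial.eval (s.γ.toFun (z 0)) (s.ω i) * deriv (fun u => s.γ.toFun u i) (z 0)).re) ∧
      evalCombination C = ((ρ.value : ℝ) : ℂ) ∧ KZ.of ρ - ∑ s ∈ C.support, KZ.of (R s) ∈ M₁ := by
  classical
  intro A B hA hB hD M hM₂ hM₃ ρ ⟨a, b, ha, hb, hab, hdom, hpos, P, D, hDne, htor, hint⟩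
  have value_of_unitCell : ∀ (ρ : KZ.IntegralRep 1), ρ.domain = {z | z 0 ∈ Set.Ioo (0 : ℝ) 1} →
      ρ.value = ∫ t in (0 : ℝ)..1, ρ.integrand (fun _ => t) := by
    intro ρ hdom
    rw [KZ.IntegralRep.value, hdom]
    have h := Summit.KontsevichZagierPeriods.SymplecticScissors.RealOnePeriodRelationsNegative.setIntegral_unitDom
      (fun t => ρ.integrand (fun _ => t))
    rw [← h]
    refine setIntegral_congr_fun
      Summit.KontsevichZagierPeriods.SymplecticScissors.RealOnePeriodRelationsNegative.measurableSet_unitDom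
      (fun z _ => ?_)
    show ρ.integrand z = ρ.integrand (fun _ => z 0)
    congr 1
    exact KZ.eq_const_apply_zero z
  -- the invariants of `M` are algebraic
  have h₂ : IsAlgebraic ℚ M.g₂ := by rw [hM₂]; exact ((isAlgebraic_int 4).neg).mul hA.algebraMap
  have h₃ : IsAlgebraic ℚ M.g₃ := by rw [hM₃]; exact ((isAlgebraic_int 4).neg).mul hB.algebraMap
  -- the complexification `D'` of `D`: its root set `T`, multiplicities `m`, leading coefficient `lc`
  set D' : Polynomial ℂ := D.map (algebraMap (algebraicClosure ℚ ℝ) ℂ) with hD'def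
  have hevalC : ∀ z : ℂ, D'.eval z = Polynomial.aeval z D := fun z => Polynomial.eval_map_algebraMap D z
  have hevalR : ∀ x : ℝ, D'.eval (x : ℂ) = ((Polynomial.aeval x D : ℝ) : ℂ) := fun x => by
    rw [hevalC, ← Complex.coe_algebraMap, Polynomial.aeval_algebraMap_apply]
  have hD'0 : D' ≠ 0 := fun h => hDne a (left_mem_Icc.2 hab.le) (by
    have e := hevalR a
    rw [h, Polynomial.eval_zero] at e
    exact_mod_cast e.symm)
  set T : Finset ℂ := D'.roots.toFinset with hTdef
  set m : ℂ → ℕ := fun e => D'.rootMultiplicity e with hmdef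
  set lc : ℂ := D'.leadingCoeff with hlcdef
  have hmemT : ∀ e, e ∈ T ↔ Polynomial.aeval e D = 0 := fun e => by
    rw [hTdef, Multiset.mem_toFinset, Polynomial.mem_roots hD'0, Polynomial.IsRoot.def, hevalC]
  have hsplit : D' = Polynomial.C lc * ∏ e ∈ T, (Polynomial.X - Polynomial.C e) ^ m e := by
    have h := (IsAlgClosed.splits D').eq_prod_roots
    rwa [Polynomial.prod_multiset_root_eq_finset_root] at h
  have hlc : IsAlgebraic ℚ lc := by
    simp only [hlcdef, Polynomial.leadingCoeff, hD'def, Polynomial.coeff_map]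
    exact (mem_algebraicClosure_iff.mp (D.coeff _).2).algebraMap
  -- the roots of `D`: algebraic torsion abscissae off `[a, b]`
  have hTtor : ∀ e ∈ T, ∃ v : ℂ, IsAlgPt M v ∧ (∃ n : ℕ, 1 ≤ n ∧ (n : ℂ) * v ∈ M.lattice) ∧ ℘[M] v = e := by
    intro e he
    obtain ⟨v, hv, ⟨n, hn, hnv⟩, h℘⟩ := htor e ((hmemT e).1 he)
    exact ⟨v, isAlgPt_of_torsion M h₂ h₃ hv hn hnv, ⟨n, hn, hnv⟩, h℘⟩
  have hTalg : ∀ e ∈ T, IsAlgebraic ℚ e := fun e he => by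
    obtain ⟨v, hv, -, rfl⟩ := hTtor e he
    exact hv.weierstrassP
  have hT : ∀ e ∈ T, IsAlgebraic ℚ e ∧ ∀ x ∈ Icc a b, (x : ℂ) ≠ e := fun e he =>
    ⟨hTalg e he, fun x hx hxe => hDne x hx (by
      have h0 := (hmemT e).1 he
      rw [← hxe, ← hevalC, hevalR] at h0
      exact_mod_cast h0)⟩
  -- the path `Γ` on `C_T` (and `γ = ι ∘ Γ` for the chain rule), the form `Q · ι^*(G dx + H dy)`
  obtain ⟨γ, hγ, -⟩ := EllipticLayer.stub_ellPath A B a b hA hB ha hb hab hD hpos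
  obtain ⟨Γ, hΓ, hSA⟩ := exists_pathPC (f := fun x => x ^ 3 + A * x + B)
    (xt := fun t => a + (b - a) * (3 * t ^ 2 - 2 * t ^ 3)) (fun _ => rfl) (fun _ => rfl)
    hA hB ha hb hab hD hpos hM₂ hM₃ hT
  obtain ⟨G, H, hG, hH, hGH⟩ := EllipticLayer.stub_ellForm A B hA hB hD 0 0 P
  have hω : ∀ i, HasAlgCoeffs ((![G, H] : Fin 2 → MvPolynomial (Fin 2) ℂ) i) := fun i => by
    fin_cases i; exacts [hG, hH]
  set Q : MvPolynomial (Fin 3) ℂ := C lc⁻¹ * ∏ e ∈ T, invX T e ^ m e with hQdef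
  have hQ : HasAlgCoeffs Q :=
    (hasAlgCoeffs_C hlc.inv).mul (hasAlgCoeffs_finsetProd _ _ fun e _ => (hasAlgCoeffs_invX hTalg _).pow _)
  have hωT : ∀ i, HasAlgCoeffs ((Q • formPullback iota ![G, H] : Fin 3 → MvPolynomial (Fin 3) ℂ) i) :=
    fun i => hQ.mul (HasAlgCoeffs.formPullback hasAlgCoeffs_iota hω i)
  set sy : PeriodSymbol := ⟨curveP M T, smoothP M h₂ h₃ hTalg, Q • formPullback iota ![G, H], hωT, Γ⟩ with hsy
  obtain ⟨R₁, hR₁dom, hR₁⟩ := stub_realises sy.Z sy.γ hSA sy.ω sy.ω_algebraic 1 isAlgebraic_one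
  -- the cubic reparametrisation maps `(0,1)` into `(a,b)`
  have hxmem : ∀ t ∈ Set.Ioo (0 : ℝ) 1, a + (b - a) * (3 * t ^ 2 - 2 * t ^ 3) ∈ Set.Ioo a b := by
    intro t ht
    have hba : 0 < b - a := sub_pos.2 hab
    have h1 : 0 < 3 * t ^ 2 - 2 * t ^ 3 := by nlinarith [ht.1, ht.2, sq_nonneg t]
    have h2 : 3 * t ^ 2 - 2 * t ^ 3 < 1 := by nlinarith [ht.1, ht.2, sq_nonneg (1 - t), mul_pos ht.1 ht.1]
    constructor <;> nlinarith [mul_pos hba h1, mul_pos hba (sub_pos.2 h2)]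
  -- the realisation integrand on `(0,1)` is `ρ.integrand(x(t)) · x′(t)`
  have hRint : ∀ t ∈ Set.Ioo (0 : ℝ) 1,
      (∑ i, MvPolynomial.eval (sy.γ.toFun t) (sy.ω i) * deriv (fun u => sy.γ.toFun u i) t) =
        ((ρ.integrand (fun _ => a + (b - a) * (3 * t ^ 2 - 2 * t ^ 3)) * ((b - a) * (6 * t - 6 * t ^ 2)) : ℝ) : ℂ) := by
    intro t ht
    have hx := hxmem t ht
    have hfpos := hpos _ hx
    have hq : Γ.toFun t ∈ (curveP M T).points := Γ.mem_points t (Ioo_subset_Icc_self ht)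
    set x : ℝ := a + (b - a) * (3 * t ^ 2 - 2 * t ^ 3) with hxdef
    set y : ℝ := Real.sqrt (x ^ 3 + A * x + B) with hydef
    have hy0 : 0 < y := Real.sqrt_pos.2 hfpos
    have hy2 : y ^ 2 = x ^ 3 + A * x + B := Real.sq_sqrt hfpos.le
    have h1 := EllipticLayer.stub_ellIntegrand A B a b γ G H hγ t ht hfpos
    have hγt : γ.toFun t = ![(x : ℂ), (y : ℂ)] := by rw [hγ t]
    have hΓt : Γ.toFun t = ![(x : ℂ), (y : ℂ), (∏ e ∈ T, ((x : ℂ) - e))⁻¹] := by rw [hΓ t]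
    -- the first two coordinates of `Γ` are those of `γ`
    have e0 : deriv (fun u => Γ.toFun u 0) t = deriv (fun u => γ.toFun u 0) t := by
      have : (fun u => Γ.toFun u 0) = fun u => γ.toFun u 0 := funext fun u => by rw [hΓ u, hγ u]; rfl
      rw [this]
    have e1 : deriv (fun u => Γ.toFun u 1) t = deriv (fun u => γ.toFun u 1) t := by
      have : (fun u => Γ.toFun u 1) = fun u => γ.toFun u 1 := funext fun u => by rw [hΓ u, hγ u]; rfl
      rw [this]
    -- `Q(Γ(t)) = 1/D(x(t))`
    have hQt : eval (Γ.toFun t) Q = (((Polynomial.aeval x D)⁻¹ : ℝ) : ℂ) := by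
      rw [hQdef, eval_invD_of_mem hsplit hq, hΓt, Matrix.cons_val_zero, hevalR, ofReal_inv]
    show (∑ i, eval (Γ.toFun t) ((Q • formPullback iota ![G, H]) i) * deriv (fun u => Γ.toFun u i) t) = _
    rw [sum_eval_smul_formPullback_iota, hQt]
    have hsum : (∑ j, eval ![Γ.toFun t 0, Γ.toFun t 1] ((![G, H] : Fin 2 → MvPolynomial (Fin 2) ℂ) j) *
        (![deriv (fun u => Γ.toFun u 0) t, deriv (fun u => Γ.toFun u 1) t] : Fin 2 → ℂ) j) =
        ∑ j, eval (γ.toFun t) ((![G, H] : Fin 2 → MvPolynomial (Fin 2) ℂ) j) *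
          deriv (fun u => γ.toFun u j) t := by
      have hpt : (![Γ.toFun t 0, Γ.toFun t 1] : Fin 2 → ℂ) = γ.toFun t := by
        rw [hΓt, hγt]; rfl
      rw [hpt, Fin.sum_univ_two, Fin.sum_univ_two]
      simp only [Matrix.cons_val_zero, Matrix.cons_val_one, e0, e1]
    rw [hsum, h1, hγt, hGH x y hy2 hy0.ne', hint x hx, ← hydef]
    simp only [map_zero, zero_mul, zero_add]
    push_cast
    ring
  -- the realisation `R₁` is rule 2 along `x(·)` applied to `ρ`
  have hreal : ∀ t ∈ Set.Ioo (0 : ℝ) 1, R₁.integrand (fun _ => t) =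
      ρ.integrand (fun _ => a + (b - a) * (3 * t ^ 2 - 2 * t ^ 3)) * ((b - a) * (6 * t - 6 * t ^ 2)) := by
    intro t ht
    have hz : (fun _ : Fin 1 => t) ∈ R₁.domain := by rw [hR₁dom]; exact ht
    rw [hR₁ _ hz, one_mul]
    show (∑ i, MvPolynomial.eval (sy.γ.toFun t) (sy.ω i) * deriv (fun u => sy.γ.toFun u i) t).re = _
    rw [hRint t ht, Complex.ofReal_re]
  have hsub : KZ.of ρ - KZ.of R₁ ∈ M₁ := EllipticLayer.stub_ellRealise a b ha hb hab ρ R₁ hdom hR₁dom hreal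
  refine ⟨Finsupp.single sy 1, fun _ => R₁, ?_, ?_, ?_, ?_, ?_, ?_⟩
  · intro t
    by_cases h : t = sy
    · subst h; simpa using isAlgebraic_one
    · rw [Finsupp.single_apply, if_neg (Ne.symm h)]; exact isAlgebraic_zero
  · intro t ht
    rw [Finsupp.support_single _ one_ne_zero, Finset.mem_singleton] at ht
    subst ht
    exact ⟨T, hTtor, rfl⟩
  · intro t ht
    rw [Finsupp.support_single _ one_ne_zero, Finset.mem_singleton] at ht
    subst ht
    exact hSA
  · intro t ht
    rw [Finsupp.support_single _ one_ne_zero, Finset.mem_singleton] at ht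
    subst ht
    refine ⟨hR₁dom, fun z hz => ?_⟩
    rw [hR₁ z hz, Finsupp.single_eq_same]
  · -- the value: `period sy = R₁.value = ρ.value`
    have hval : R₁.value = ρ.value := by
      have h := Summit.KontsevichZagierPeriods.SymplecticScissors.RealOnePeriodRelationsNegative.eval_eq_zero_of_mem_M₁ hsub
      rw [map_sub, KZ.eval_of, KZ.eval_of, sub_eq_zero] at h
      exact h.symm
    rw [evalCombination, Finsupp.sum_single_index (by simp), one_mul, PeriodSymbol.period, ← hval,
      value_of_unitCell R₁ hR₁dom, ← intervalIntegral.integral_ofReal,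
      intervalIntegral.integral_of_le zero_le_one, intervalIntegral.integral_of_le zero_le_one,
      integral_Ioc_eq_integral_Ioo, integral_Ioc_eq_integral_Ioo]
    refine setIntegral_congr_fun measurableSet_Ioo fun t ht => ?_
    rw [hreal t ht]
    exact hRint t ht
  · rw [Finsupp.support_single _ one_ne_zero, Finset.sum_singleton]
    exact hsub

end TorsionLayer

end Summit.KontsevichZagierPeriods.SymplecticScissors.RealOnePeriodRelations

end
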